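import Summits.AtomisticToContinuum.Crystallization.Theses.PalmUnimodularRigidity
import Summits.AtomisticToContinuum.Crystallization.Theorems.MinimiserShells.Negative.LoadBearing
import Summits.AtomisticToContinuum.Crystallization.Theorems.ChargedEnergyGap.Negative.NoBoundaryReduction
import Summits.AtomisticToContinuum.Crystallization.Theorems.PalmUnimodularRigidityMinimiserShellsShellNoBoundaryOfShellGapWith
import Literature.Probability.Process.PointStationaryLaw
import Literature.MathematicalPhysics.StatisticalMechanics.LennardJonesClusters

/-!
# The boundary allowance of the QUALITATIVE shell gap is not load-bearing (stub S12, reshape r4)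

Stub `stub_qualShellNoBoundary_of_qualShellGapWith` (S12) of line `equilibrium-in-law-surgery` (reshape r4) of crux
`MinimiserShells` (stmt-AtomisticToContinuum-9225, route `PalmUnimodularRigidity`).

The threshold (qualitative) version of S10 (`…ShellNoBoundaryOfShellGapWith`): if for every threshold `t > 0` there
are `κ > 0` and `C₀` with `N · (e* + κ) − C₀ · N^(2/3) ≤ 𝓔_N(y)` for every finite injective `y : Fin N → ℝ³` having
at least `t · N` badly-shelled sites, then the same holds WITHOUT the boundary allowance, with the threshold `t`
and the excess `κ` unchanged.

Proof.  `M` far translated copies of `y` (`ChargedEnergyGapNegative.copiesFin` at spacing `spacing y`) have energy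
`≤ M · 𝓔_N(y)` (`interactionEnergy_copiesFin_le`) and EXACTLY `M` times as many badly-shelled sites
(`ShellGapAmplification.natCard_bad_copiesFin`), so they still meet the threshold `t`; hence
`(M·N)·e* + κ·(M·N) − C₀·(M·N)^(2/3) ≤ M·𝓔_N(y)` for every `M`, and `ShellGapAmplification.le_of_key` amplifies.
-/

noncomputable section

open MeasureTheory
open scoped ENNReal BigOperators

namespace Summit.AtomisticToContinuum.Crystallization.Theorems.PalmUnimodularRigidityMinimiserShells.QualShellGapAmplification

open Literature.MathematicalPhysics.StatisticalMechanics (lennardJones interactionEnergy)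
open Summit.AtomisticToContinuum.Crystallization.Theorems.MinimiserShells.Negative.LoadBearing
  (eStar GoodShell)
open Summit.AtomisticToContinuum.Crystallization.Theorems.ChargedEnergyGapNegative
  (E3 copiesFin copiesFin_injective interactionEnergy_copiesFin_le spacing one_le_spacing_sub two_Dsum_lt_spacing)
open Summit.AtomisticToContinuum.Crystallization.Theorems.PalmUnimodularRigidityMinimiserShells.ShellGapAmplification
  (natCard_bad_copiesFin le_of_key)

/-- **Stub `stub_qualShellNoBoundary_of_qualShellGapWith` (S12) of line `equilibrium-in-law-surgery`.**  The
qualitative shell gap with boundary allowance `C₀ · N^(2/3)` implies the qualitative no-boundary shell gap with the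
same threshold `t` and the same excess `κ`: far copies keep the badly-shelled FRACTION and at most add up the
energies. -/
theorem stub_qualShellNoBoundary_of_qualShellGapWith :
    (∀ t : ℝ, 0 < t → ∃ κ C₀ : ℝ, 0 < κ ∧ ∀ (N : ℕ) (y : Fin N → EuclideanSpace ℝ (Fin 3)), Function.Injective y →
      t * (N : ℝ) ≤ (Nat.card {i : Fin N // ¬ GoodShell
          ((Measure.count : Measure (EuclideanSpace ℝ (Fin 3))).restrict ((fun z => z - y i) '' Set.range y))} : ℝ) →
      (N : ℝ) * (eStar + κ) - C₀ * (N : ℝ) ^ (2 / 3 : ℝ) ≤ interactionEnergy lennardJones y) →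
    ∀ t : ℝ, 0 < t → ∃ κ : ℝ, 0 < κ ∧ ∀ (N : ℕ) (y : Fin N → EuclideanSpace ℝ (Fin 3)), Function.Injective y →
      t * (N : ℝ) ≤ (Nat.card {i : Fin N // ¬ GoodShell
          ((Measure.count : Measure (EuclideanSpace ℝ (Fin 3))).restrict ((fun z => z - y i) '' Set.range y))} : ℝ) →
      (N : ℝ) * (eStar + κ) ≤ interactionEnergy lennardJones y := by
  intro hgap t ht
  obtain ⟨κ, C₀, hκ, h⟩ := hgap t ht
  refine ⟨κ, hκ, fun N y hy hthr => ?_⟩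
  have key : (N : ℝ) * eStar + κ * N ≤ interactionEnergy lennardJones y := by
    refine le_of_key (C := C₀) fun M => ?_
    have hthrM : t * ((M * N : ℕ) : ℝ) ≤ (Nat.card {a : Fin (M * N) // ¬ GoodShell
        ((Measure.count : Measure (EuclideanSpace ℝ (Fin 3))).restrict
          ((fun z => z - copiesFin M (spacing y) y a) '' Set.range (copiesFin M (spacing y) y)))} : ℝ) := by
      rw [natCard_bad_copiesFin M y]
      push_cast
      have hM : (0 : ℝ) ≤ (M : ℝ) := Nat.cast_nonneg M
      nlinarith
    have hg := h (M * N) (copiesFin M (spacing y) y) (copiesFin_injective M (two_Dsum_lt_spacing y) hy) hthrM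
    push_cast at hg
    have hE := interactionEnergy_copiesFin_le M y (one_le_spacing_sub y)
    nlinarith
  nlinarith

end Summit.AtomisticToContinuum.Crystallization.Theorems.PalmUnimodularRigidityMinimiserShells.QualShellGapAmplification

end
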